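import Literature.NumberTheory.Automorphic.PatrikisCMDescentProofs
import Literature.NumberTheory.Automorphic.ClozelAlgebraicityRatFieldProofs
import Literature.FieldTheory.AlgClosed.AutComplexClosedSubgroups
import HarnessLib

/-!
# The Hecke stabiliser is `Aut(ℂ/ℚ(π_f))` when the eigenvalues lie in a number field, and
# Patrikis's CM descent modulo Clozel's theorem with its model clause in that form (proofs)

Proofs-only companion (theorems, no definitions, no named facts) of `ClozelAlgebraicity.lean`
and `PatrikisCMDescentProofs.lean`.

`ClozelAlgebraicity` renders Clozel's `{σ ∈ Aut(ℂ) : ^σπ_f ≅ π_f}` by the subgroup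
`heckeStabilizer π ≤ Aut(ℂ) = (ℂ ≃ₐ[ℚ] ℂ)` of automorphisms fixing the unramified Hecke
eigenvalues `t_{v,i}` of `π` at almost all places, and `ℚ(π_f)` by its fixed field
`ratField π`. For the transcendental extension `ℂ/ℚ` a subgroup of `Aut(ℂ)` need not be the
full group `Aut(ℂ/Fix)` of its fixed field, and indeed the inclusion
`Aut(ℂ/ratField π) ≤ heckeStabilizer π` — "`^σπ_f ≅ π_f` for all `σ ∈ Aut(ℂ/ℚ(π_f))`", which in
print is the MODEL clause of Clozel 1990, Thm. 3.13 ("`π_f` est définie sur `ℚ(π_f)`") and is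
the hypothesis `hmodel` of `Patrikis2019_cmDescent_of_clozel` — fails for a general eigensystem
(eigenvalues `√p_v` at infinitely many `v`: stabiliser ≠ `Aut(ℂ)`, fixed field `ℚ`). This file
proves that it holds as soon as the eigenvalues at almost all places lie in a subfield `E ⊆ ℂ`
finite over `ℚ` — the same hypothesis to which `ClozelAlgebraicityRatFieldProofs` reduces
clause (i) "`ℚ(π_f)` is a number field" (`finiteDimensional_ratField_of_heckeEigenvalue_mem`),
and the RepData shadow of "`π_f` is defined over the number field `E`" (Clozel 1990, §3.1,
Prop. 3.1; proof of Thm. 3.13, §3.5: `E` = field of rationality of `π_f ⊂ H•_cusp`):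

* `mem_heckeStabilizer_of_fix_ratField_of_heckeEigenvalue_mem` — eigenvalues in a number field
  `E ⊆ ℂ` at almost all places ⟹ every `σ ∈ Aut(ℂ)` fixing `ratField π` pointwise lies in
  `heckeStabilizer π` (by `Complex.mem_subgroup_of_fix_fixedField` of
  `FieldTheory/AlgClosed/AutComplexClosedSubgroups`: subgroups of `Aut(ℂ)` containing `Aut(ℂ/E)`
  are closed, applied with `mem_heckeStabilizer_of_heckeEigenvalue_mem`);
* `fixingSubgroup_ratField_eq_heckeStabilizer_of_heckeEigenvalue_mem`,
  `mem_heckeStabilizer_iff_fix_ratField_of_heckeEigenvalue_mem` — so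
  `heckeStabilizer π = Aut(ℂ/ℚ(π_f))` exactly, i.e. `σ` stabilises the eigensystem iff it fixes
  `ℚ(π_f)` (Clozel 1990, §3.1: for `π_f` defined over a number field, `^σπ_f ≅ π_f` iff
  `σ ∈ Aut(ℂ/ℚ(π_f))`);
* `Patrikis2019_cmDescent_of_clozel_of_heckeEigenvalue_mem` — **Patrikis 2019, Prop. 2.4.7 with
  Rem. 2.4.8 (1), from Clozel's theorem with its model clause read on eigenvalues**: the named
  fact `Patrikis2019_cmDescent` follows from `Clozel1990_regularAlgebraic` (Thm. 3.13 (i), (ii),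
  (iv) as vendored), (a') for every cuspidal regular algebraic `π` the unramified Hecke
  eigenvalues at almost all places lie in some subfield of `ℂ` finite over `ℚ` (Thm. 3.13:
  `π_f` is defined over the number field `ℚ(π_f)`), and (b) strong multiplicity one with the
  archimedean components for cuspidal data (Jacquet–Shalika 1981, Thm. 4.4) — the hypothesis
  `hmodel` of `Patrikis2019_cmDescent_of_clozel` being supplied by the first theorem.

So, of the three inputs of `Patrikis2019_cmDescent_of_clozel` beyond the Galois theory proved in
`NumberFields/CMDescentEmbeddings`, the model clause (a) is now subsumed by the eigenvalue
statement (a'), which any proof of clause (i) of `Clozel1990_regularAlgebraic` passes through;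
what remains unproved is Clozel's Thm. 3.13 itself ((i), (ii), (iv) and (a')) and (b).

## References

* L. Clozel, *Motifs et formes automorphes: applications du principe de fonctorialité*, in
  Automorphic forms, Shimura varieties, and L-functions I (Ann Arbor 1988), Academic Press 1990,
  §3.1 (Prop. 3.1, `ℚ(π_f)`), Thm. 3.13 and its proof in §3.5. [Clozel1990]
* S. Patrikis, *Variations on a theorem of Tate*, Mem. AMS 258 (2019), no. 1238
  (= arXiv:1207.6724), §2.4: Thm. (Clozel), Hypothesis, Cor. 2.4.6, Prop. 2.4.7, Rem. 2.4.8 (1)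
  (arXiv §3.2: Thm. 3.2.1, Hyp. 3.2.2, Cor. 3.2.3, Prop. `cmdescent`). [Patrikis2019]
* H. Jacquet, J. Shalika, *On Euler products and the classification of automorphic forms II*,
  Amer. J. Math. 103 (1981), Thm. 4.4. [JacquetShalika1981]
* S. Lang, *Algebra*, rev. 3rd ed., GTM 211 (2002), Ch. VI §1. [Lang2002]
-/

noncomputable section

open scoped Classical
open NumberField IsDedekindDomain IntermediateField

namespace Literature.NumberTheory.Automorphic

open Literature.FieldTheory.AlgClosed

/-! ### `heckeStabilizer π = Aut(ℂ/ℚ(π_f))` when the eigenvalues lie in a number field -/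

section Stabilizer

variable {n : ℕ} {K : Type} [Field K] [NumberField K] {hcpt : isCompact_glFiniteIntegralLevel n K}

/-- **`Aut(ℂ/ℚ(π_f))` stabilises the Hecke eigensystem when the eigenvalues lie in a number
field** (the model clause of Clozel 1990, Thm. 3.13, read on unramified Hecke eigenvalues). If at
all but finitely many finite places every unramified Hecke eigenvalue `t_{v,i}` (`0 ≤ i ≤ n`) of
`π` lies in a subfield `E ⊆ ℂ` finite over `ℚ`, then every `σ ∈ Aut(ℂ)` fixing `ratField π`
(`= ℚ(π_f)`, the fixed field of `heckeStabilizer π`) pointwise belongs to `heckeStabilizer π`: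
`Aut(ℂ/E) ≤ heckeStabilizer π` (`mem_heckeStabilizer_of_heckeEigenvalue_mem`), and a subgroup of
`Aut(ℂ)` containing `Aut(ℂ/E)`, `E` a number field, contains `Aut(ℂ/Fix)` of its fixed field
(`Complex.mem_subgroup_of_fix_fixedField`). [cite: Clozel1990, §3.1 and Thm. 3.13 (model of `π_f` over `ℚ(π_f)`)] -/
theorem mem_heckeStabilizer_of_fix_ratField_of_heckeEigenvalue_mem
    (π : AutomorphicRepData (AutomorphyDatum.gl n K hcpt)) {E : Subfield ℂ}
    [FiniteDimensional ℚ E]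
    (hE : ∀ᶠ v : HeightOneSpectrum (𝓞 K) in Filter.cofinite, ∀ α : Multiset ℂ,
      π.HasSatakeParamAt v α → ∀ i ≤ n, heckeEigenvalueOf n v α i ∈ E)
    (σ : ℂ ≃ₐ[ℚ] ℂ) (hσ : ∀ z ∈ ratField π, σ z = z) : σ ∈ heckeStabilizer π :=
  Complex.mem_subgroup_of_fix_fixedField (heckeStabilizer π) E
    (mem_heckeStabilizer_of_heckeEigenvalue_mem π hE) fun z hz ↦ hσ z hz

/-- **`heckeStabilizer π = Aut(ℂ/ℚ(π_f))`** when the eigenvalues at almost all places lie in a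
number field `E ⊆ ℂ`: the subgroup of `Aut(ℂ)` fixing `ratField π` pointwise is exactly the Hecke
stabiliser (Clozel 1990, §3.1: for `π_f` defined over a number field, `^σπ_f ≅ π_f` iff `σ`
fixes `ℚ(π_f)`). [cite: Clozel1990, §3.1 and Thm. 3.13 (model of `π_f` over `ℚ(π_f)`)] -/
theorem fixingSubgroup_ratField_eq_heckeStabilizer_of_heckeEigenvalue_mem
    (π : AutomorphicRepData (AutomorphyDatum.gl n K hcpt)) {E : Subfield ℂ}
    [FiniteDimensional ℚ E]
    (hE : ∀ᶠ v : HeightOneSpectrum (𝓞 K) in Filter.cofinite, ∀ α : Multiset ℂ,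
      π.HasSatakeParamAt v α → ∀ i ≤ n, heckeEigenvalueOf n v α i ∈ E) :
    (ratField π).fixingSubgroup = heckeStabilizer π :=
  Complex.fixingSubgroup_fixedField_eq (heckeStabilizer π) E
    (mem_heckeStabilizer_of_heckeEigenvalue_mem π hE)

/-- Membership form of `fixingSubgroup_ratField_eq_heckeStabilizer_of_heckeEigenvalue_mem`:
when the eigenvalues at almost all places lie in a number field, `σ` stabilises the unramified
Hecke eigensystem of `π` iff `σ` fixes `ℚ(π_f) = ratField π` pointwise. [cite: Clozel1990, §3.1 and Thm. 3.13 (model of `π_f` over `ℚ(π_f)`)] -/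
theorem mem_heckeStabilizer_iff_fix_ratField_of_heckeEigenvalue_mem
    (π : AutomorphicRepData (AutomorphyDatum.gl n K hcpt)) {E : Subfield ℂ}
    [FiniteDimensional ℚ E]
    (hE : ∀ᶠ v : HeightOneSpectrum (𝓞 K) in Filter.cofinite, ∀ α : Multiset ℂ,
      π.HasSatakeParamAt v α → ∀ i ≤ n, heckeEigenvalueOf n v α i ∈ E)
    (σ : ℂ ≃ₐ[ℚ] ℂ) : σ ∈ heckeStabilizer π ↔ ∀ z ∈ ratField π, σ z = z := by
  rw [← fixingSubgroup_ratField_eq_heckeStabilizer_of_heckeEigenvalue_mem π hE,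
    IntermediateField.mem_fixingSubgroup_iff]

end Stabilizer

/-! ### Patrikis's CM descent from Clozel's theorem with the model clause on eigenvalues -/

section Patrikis

/-- **`Patrikis2019_cmDescent` from Clozel's theorem, eigenvalues in a number field, and strong
multiplicity one** (Patrikis 2019, Prop. 2.4.7 with Rem. 2.4.8 (1)). Assume the named fact
`Clozel1990_regularAlgebraic` (Clozel 1990, Thm. 3.13 (i), (ii), (iv) as vendored) and, for every
cuspidal regular algebraic `π` on every `GL_n(𝔸_K)`, (a') the unramified Hecke eigenvalues of
`π` at almost all places lie in a subfield of `ℂ` finite over `ℚ` (Thm. 3.13: `π_f` is defined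
over the number field `ℚ(π_f)`; the RepData shadow of the model clause) and (b) nearly
equivalent cuspidal representations have infinity types with the same `a`-multisets
(Jacquet–Shalika 1981, Thm. 4.4, strong multiplicity one including the archimedean components).
Then the fact holds: (a') gives `Aut(ℂ/ℚ(π_f)) ≤ heckeStabilizer π`
(`mem_heckeStabilizer_of_fix_ratField_of_heckeEigenvalue_mem`), which is the model hypothesis of
`Patrikis2019_cmDescent_of_clozel`. [cite: Patrikis2019, Prop. 2.4.7 and Rem. 2.4.8 (1) (Mem. AMS numbering; arXiv:1207.6724 §3.2)] -/
theorem Patrikis2019_cmDescent_of_clozel_of_heckeEigenvalue_mem (hC : Clozel1990_regularAlgebraic)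
    (hrat : ∀ (n : ℕ) (K : Type) [Field K] [NumberField K]
      (hcpt : isCompact_glFiniteIntegralLevel n K) (π : CuspidalAutomorphicRepData n K hcpt),
      π.1.IsRegularAlgebraic →
        ∃ E : Subfield ℂ, FiniteDimensional ℚ E ∧
          ∀ᶠ v : HeightOneSpectrum (𝓞 K) in Filter.cofinite, ∀ α : Multiset ℂ,
            π.1.HasSatakeParamAt v α → ∀ i ≤ n, heckeEigenvalueOf n v α i ∈ E)
    (hsmo : ∀ (n : ℕ) (K : Type) [Field K] [NumberField K]
      (hcpt : isCompact_glFiniteIntegralLevel n K) (π π' : CuspidalAutomorphicRepData n K hcpt),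
      π.1.IsNearlyEquivalent π'.1 → ∀ T T' : InfinityType K n,
        π.1.HasInfinityType T → π'.1.HasInfinityType T' →
          ∀ ι : K →+* ℂ, (T ι).map ArchWeight.a = (T' ι).map ArchWeight.a) :
    Patrikis2019_cmDescent := by
  refine Patrikis2019_cmDescent_of_clozel hC (fun n K _ _ hcpt π hπ σ hσ ↦ ?_) hsmo
  obtain ⟨E, hfd, hE⟩ := hrat n K hcpt π hπ
  haveI := hfd
  exact mem_heckeStabilizer_of_fix_ratField_of_heckeEigenvalue_mem π.1 hE σ hσ

end Patrikis

end Literature.NumberTheory.Automorphic
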